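import Mathlib.Combinatorics.SimpleGraph.Connectivity.Finite
import Mathlib.Combinatorics.SimpleGraph.Basic
import Mathlib.Data.Fintype.Card
import Mathlib.Data.Fin.Tuple.Basic
import Mathlib.Algebra.Group.Units.Basic
import Mathlib.Algebra.BigOperators.Group.Finset.Basic
import Literature.Topology.FourManifolds.GaussDiagrams
import Literature.Topology.FourManifolds.Knots
import HarnessLib

-- D-0014 sorry-sweep (operator, 2026-08-13): sorried theorems -> named facts `def X : Prop`; partial proofs preserved in comments
-- provenance: harness21/H21/H21/Prelude/FourManL/KhResolutions.lean @ 585521a (interim HEAD d8f2665); M5 mechanical rewrite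
/-!
# Complete resolutions of a Gauss diagram (trunk T-4MAN / FourManL, outline C12)

This prelude file of the H21 library (trunk `FourManL`; notion `khovanov_homology_rasmussen_s`,
layer 1 of the Khovanov–Lee–Rasmussen tower `KhResolutions → KhComplex → LeeRasmussen`)
provides the *complete resolutions* (Kauffman states) of a Gauss diagram
`G : Literature.GaussDiagram` (`Literature.Prelude.FourManM.GaussDiagrams`) as abstract circle surgery,
following Viro's combinatorial description of Khovanov's complex:

* chord bookkeeping: `chordOf p` (the chord through the marked point `p`, computable via
  `Fin.find`), `partner p` (the other end of that chord), the bridge `chordOf_eq_endEquiv_symm`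
  to the accepted `GaussDiagram.endEquiv`, `nPlus`, `nMinus` and `writhe_eq_sub`;
* states `State := Fin G.n → Bool` (`false` = 0-smoothing, `true` = 1-smoothing), their
  `weight`, and the Seifert rule `isSeifert` deciding at each chord whether the chosen
  smoothing is the orientation-consistent one;
* the resolved 1-manifold of a state: the `2n` arcs `Arc` of the circle, the reconnection
  graph `stateGraph σ` on them, its connected components `StateCircle σ` (the *state
  circles*), `circleCount σ`, `circleOf σ a`;
* the three-way case split at a `0`-smoothed chord: `IsMergeAt`, `IsSplitAt`, or neither
  (the third case occurs only for non-realisable, i.e. virtual, Gauss diagrams), with the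
  named facts `IsMergeAt.not_isSplitAt` (proved: `IsMergeAt.not_isSplitAt_holds`, by a parity
  count on arc-ends, section `NotSplit` at the end of the file) and
  `isMergeAt_or_isSplitAt_of_hasGaussDiagram` (planarity, Jordan curve theorem);
* sanity data `kink ε`, `trefoilDiagram` and `decide`d sanity lemmas guarding the sign rule
  in `isSeifert` (`circleCount_kink_false = 2`, `circleCount_trefoil_false = 2`, …).

## Sources

* M. Khovanov, *A categorification of the Jones polynomial*, Duke Math. J. 101 (2000)
  359–426, §4 (cube of resolutions).
* D. Bar-Natan, *On Khovanov's categorification of the Jones polynomial*, Algebr. Geom.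
  Topol. 2 (2002) 337–370, §3.1 (smoothings, `n₊`, `n₋`, gradings).
* O. Viro, *Khovanov homology, its definitions and ramifications*, Fund. Math. 184 (2004)
  317–342, §2–5 (enhanced Kauffman states; §5: Gauss diagrams / virtual case).
* J. Rasmussen, *Khovanov homology and the slice genus*, Invent. Math. 182 (2010) 419–447,
  §2 (grading conventions).
* V. O. Manturov, *Khovanov homology for virtual knots with arbitrary coefficients*,
  Izv. Math. 71 (2007) 967–999; J. Knot Theory Ramifications 16 (2007) 345–377 (the
  one-to-one bifurcation for virtual diagrams).
* M. Polyak, *Minimal generating sets of Reidemeister moves*, Quantum Topol. 1 (2010) 29–46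
  (Gauss diagrams).
* Mathlib: nothing on knot diagrams, Kauffman states or Khovanov homology (searched
  `Khovanov`, `Kauffman`, `smoothing`, `Gauss diagram`); we use `Fin.find`,
  `SimpleGraph.fromRel`, `SimpleGraph.ConnectedComponent` (with its `Fintype` instance from
  `Mathlib.Combinatorics.SimpleGraph.Connectivity.Finite`), `Fintype.card`, `Function.update`.

## Design choices

* Everything lives in `namespace Literature.GaussDiagram` and takes `(G : GaussDiagram)`, so that
  dot notation `G.circleCount σ` etc. is available on the accepted structure.
* `chordOf` is defined by `Fin.find` (computable, reduces under `decide`) rather than through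
  the accepted `endEquiv.symm` (an `Equiv.ofBijective`, whose inverse is
  `Classical.choice` and blocks `decide`); `endEquiv` is *used, not redefined*: the bridge
  lemma `chordOf_eq_endEquiv_symm` identifies the two.
* The resolved 1-manifold of a state is defined *abstractly*, as the surgery of the circle
  along the chords: at a chord where the chosen smoothing is Seifert's (orientation
  consistent) the band is untwisted, otherwise it is half-twisted. This needs no planarity,
  so all definitions are total on `GaussDiagram` (which contains virtual diagrams); only the
  dichotomy merge/split (`isMergeAt_or_isSplitAt_of_hasGaussDiagram`) needs realisability.
* `arcCount := max (2 * G.n) 1`: the empty diagram (round unknot diagram) has one arc, hence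
  one state circle (`circleCount_empty`), which is semantically necessary (the unknot must
  have the two enhanced states `1`, `X` in the next layer). `arcOut`, `arcIn` are direct
  `Fin.mk`s with `omega` bounds.
* State circles are connected components of a `SimpleGraph` on arcs; `SimpleGraph.fromRel`
  symmetrises and removes loops, which does not change connectivity. `DecidableEq` on the
  quotient `ConnectedComponent` is core's `Quotient.decidableEq` on `reachableSetoid`
  (reachability is decidable on a finite graph with decidable adjacency), so that all sanity
  lemmas are provable by `decide`.
* Sign conventions follow Bar-Natan (2002) and Rasmussen (2010): homological degree
  `weight − n₋`, oriented resolution in degree `0`; hence the Seifert smoothing is the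
  `0`-smoothing at a positive crossing and the `1`-smoothing at a negative one (`isSeifert`).
  The sanity lemmas on `kink` and `trefoilDiagram` are the guard on this rule.
-/

open Function Set

noncomputable section

namespace Literature.Topology.FourManifolds

namespace GaussDiagram

variable (G : GaussDiagram)

/-! ## Chord bookkeeping -/

/-- Every marked point of a Gauss diagram is an end (over- or under-passage) of some chord
(surjectivity half of `GaussDiagram.bijective`). GPV (2000), §1.2. [cite: GPV2000] -/
theorem exists_chord (p : Fin (2 * G.n)) : ∃ i, G.overPos i = p ∨ G.underPos i = p := by
  obtain ⟨i | i, hi⟩ := G.bijective.surjective p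
  · exact ⟨i, Or.inl hi⟩
  · exact ⟨i, Or.inr hi⟩

/-- `overPos` is injective (from `GaussDiagram.bijective`). [folklore] -/
theorem overPos_injective : Injective G.overPos := fun i j h ↦
  Sum.inl_injective (G.bijective.injective (a₁ := .inl i) (a₂ := .inl j) h)

/-- `underPos` is injective (from `GaussDiagram.bijective`). [folklore] -/
theorem underPos_injective : Injective G.underPos := fun i j h ↦
  Sum.inr_injective (G.bijective.injective (a₁ := .inr i) (a₂ := .inr j) h)

/-- An over-passage is never an under-passage (from `GaussDiagram.bijective`). [folklore] -/
theorem overPos_ne_underPos (i j : Fin G.n) : G.overPos i ≠ G.underPos j := fun h ↦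
  Sum.inl_ne_inr (G.bijective.injective (a₁ := .inl i) (a₂ := .inr j) h)

/-- The **chord through the marked point** `p`: the unique chord `i` with `overPos i = p` or
`underPos i = p`. Defined by `Fin.find` so that it is computable and reduces under `decide`
(see `chordOf_eq_endEquiv_symm` for the description through the accepted `endEquiv`).
GPV (2000), §1.2. [cite: GPV2000] -/
def chordOf (p : Fin (2 * G.n)) : Fin G.n :=
  Fin.find (fun i ↦ G.overPos i = p ∨ G.underPos i = p) (G.exists_chord p)

/-- The defining property of `chordOf p`: `p` is one of its two ends. [folklore] -/
theorem chordOf_spec (p : Fin (2 * G.n)) :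
    G.overPos (G.chordOf p) = p ∨ G.underPos (G.chordOf p) = p :=
  Fin.find_spec (G.exists_chord p)

/-- The chord through the over-passage of chord `i` is `i`. [folklore] -/
@[simp]
theorem chordOf_overPos (i : Fin G.n) : G.chordOf (G.overPos i) = i := by
  rcases G.chordOf_spec (G.overPos i) with h | h
  · exact G.overPos_injective h
  · exact ((G.overPos_ne_underPos _ _) h.symm).elim

/-- The chord through the under-passage of chord `i` is `i`. [folklore] -/
@[simp]
theorem chordOf_underPos (i : Fin G.n) : G.chordOf (G.underPos i) = i := by
  rcases G.chordOf_spec (G.underPos i) with h | h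
  · exact ((G.overPos_ne_underPos _ _) h).elim
  · exact G.underPos_injective h

/-- Bridge to the accepted `GaussDiagram.endEquiv`: `chordOf p` is the chord index of the
chord end `endEquiv.symm p : Fin n ⊕ Fin n` (forgetting whether it is an over- or an
under-passage). [folklore] -/
theorem chordOf_eq_endEquiv_symm (p : Fin (2 * G.n)) :
    G.chordOf p = Sum.elim id id (G.endEquiv.symm p) := by
  obtain ⟨i, rfl | rfl⟩ := G.exists_chord p
  · have h : G.endEquiv.symm (G.overPos i) = Sum.inl i := by
      rw [Equiv.symm_apply_eq, endEquiv_inl]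
    simp [h]
  · have h : G.endEquiv.symm (G.underPos i) = Sum.inr i := by
      rw [Equiv.symm_apply_eq, endEquiv_inr]
    simp [h]

/-- The **partner** of the marked point `p`: the other end of the chord through `p`
(`underPos i` if `p = overPos i`, `overPos i` if `p = underPos i`). GPV (2000), §1.2. [cite: GPV2000] -/
def partner (p : Fin (2 * G.n)) : Fin (2 * G.n) :=
  if G.overPos (G.chordOf p) = p then G.underPos (G.chordOf p) else G.overPos (G.chordOf p)

/-- The partner of an over-passage is the under-passage of the same chord. [folklore] -/
@[simp]
theorem partner_overPos (i : Fin G.n) : G.partner (G.overPos i) = G.underPos i := by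
  simp [partner]

/-- The partner of an under-passage is the over-passage of the same chord. [folklore] -/
@[simp]
theorem partner_underPos (i : Fin G.n) : G.partner (G.underPos i) = G.overPos i := by
  simp [partner, (G.overPos_ne_underPos i i)]

/-- `partner` is an involution. [folklore] -/
@[simp]
theorem partner_partner (p : Fin (2 * G.n)) : G.partner (G.partner p) = p := by
  obtain ⟨i, rfl | rfl⟩ := G.exists_chord p <;> simp

/-- The chord through the partner of `p` is the chord through `p`. [folklore] -/
@[simp]
theorem chordOf_partner (p : Fin (2 * G.n)) : G.chordOf (G.partner p) = G.chordOf p := by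
  obtain ⟨i, rfl | rfl⟩ := G.exists_chord p <;> simp

/-- The number `n₊` of **positive crossings** (chords of sign `+1`) of a Gauss diagram.
Bar-Natan (2002), §3.1. [cite: BarNatan2002] -/
def nPlus : ℕ := (Finset.univ.filter fun i ↦ G.sign i = 1).card

/-- The number `n₋` of **negative crossings** (chords of sign `-1`) of a Gauss diagram.
Bar-Natan (2002), §3.1. [cite: BarNatan2002] -/
def nMinus : ℕ := (Finset.univ.filter fun i ↦ G.sign i = -1).card

/-- The writhe (accepted `GaussDiagram.writhe`, the sum of the signs) is `n₊ - n₋`.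
Bar-Natan (2002), §3.1; Kauffman (1987), Ch. II. [cite: BarNatan2002] -/
theorem writhe_eq_sub : G.writhe = (G.nPlus : ℤ) - G.nMinus := by
  have h : ∀ i, (G.sign i : ℤ) = if G.sign i = 1 then (1 : ℤ) else -1 := fun i ↦ by
    rcases Int.units_eq_one_or (G.sign i) with h | h <;> rw [h] <;> decide
  have hf : (Finset.univ.filter fun i ↦ ¬ G.sign i = 1) =
      Finset.univ.filter fun i ↦ G.sign i = -1 :=
    Finset.filter_congr fun i _ ↦ by
      rcases Int.units_eq_one_or (G.sign i) with h | h <;> rw [h] <;> decide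
  simp only [writhe, h, Finset.sum_ite, Finset.sum_const, hf, nPlus, nMinus]
  ring

/-! ## States and the Seifert rule -/

/-- A **state** (complete resolution, Kauffman state) of a Gauss diagram: a choice of
smoothing at every chord, `false` for the `0`-smoothing (`A`-smoothing) and `true` for the
`1`-smoothing (`B`-smoothing). Khovanov (2000), §4.2; Bar-Natan (2002), §3.1;
Viro (2004), §2. [cite: Khovanov2000] -/
abbrev State : Type := Fin G.n → Bool

/-- The **weight** (height) `|σ|` of a state: the number of `1`-smoothings. Bar-Natan (2002),
§3.1 (the height of a vertex of the cube of resolutions). [cite: BarNatan2002] -/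
def State.weight {G : GaussDiagram} (σ : G.State) : ℕ :=
  (Finset.univ.filter fun i ↦ σ i = true).card

/-- The **Seifert rule**: `G.isSeifert σ i` records whether, in the state `σ`, the smoothing
chosen at chord `i` is *Seifert's* smoothing. At a crossing exactly one of the two smoothings
reconnects the four local strand ends consistently with the orientation of the knot (the
smoothing used in Seifert's algorithm); it is the `0`-smoothing at a positive crossing and
the `1`-smoothing at a negative crossing. This is forced by the grading normalisation
`homDegree = weight - n₋` (Bar-Natan (2002), §3.1; Rasmussen (2010), §2), under which the
oriented resolution sits in homological degree `0`, and by invariance of the Kauffman bracket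
under a positive kink; Khovanov (2000), §4; Bar-Natan (2002), §3. Abstractly, the resolved
1-manifold of a state is the surgery of the circle along the chords, along an untwisted
(orientation-consistent) band at the Seifert chords and along a half-twisted
(orientation-reversing) band at the others (Viro (2004), §5); it is therefore determined by
the Gauss diagram alone, and no planarity is needed to *define* it. [cite: BarNatan2002] -/
def isSeifert (σ : G.State) (i : Fin G.n) : Bool :=
  (σ i == false) == (G.sign i == 1)

/-! ## Arcs and state circles -/

/-- The number of **arcs** of the based circle of a Gauss diagram cut at its `2n` marked
points: `2n`, except that the empty diagram (round unknot diagram, no marked point) has one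
arc, the whole circle (`max (2 * n) 1`). Viro (2004), §2. [cite: Viro2004] -/
def arcCount : ℕ := max (2 * G.n) 1

/-- The type of **arcs** of a Gauss diagram: arc `q` runs from the marked point `q` to the
marked point `q + 1 (mod 2n)` in the direction of the orientation (for the empty diagram, the
single arc is the whole circle). Viro (2004), §2. [cite: Viro2004] -/
abbrev Arc : Type := Fin G.arcCount

/-- The arc **leaving** the marked point `p` (arc number `p`). [folklore] -/
def arcOut (p : Fin (2 * G.n)) : G.Arc :=
  ⟨p.val, by have := p.isLt; unfold arcCount; omega⟩

/-- The arc **entering** the marked point `p` (arc number `p - 1 (mod 2n)`). [folklore] -/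
def arcIn (p : Fin (2 * G.n)) : G.Arc :=
  ⟨(p.val + 2 * G.n - 1) % (2 * G.n), by
    have hp := p.isLt
    have := Nat.mod_lt (p.val + 2 * G.n - 1) (show 0 < 2 * G.n by omega)
    unfold arcCount; omega⟩

/-- The **reconnection relation** of the state `σ` on arcs: two distinct arcs are related if
they are glued end to end by the smoothing of some chord `{p, p'}` (`p' = partner p`). At a
chord where the smoothing is Seifert's (`isSeifert`), the strand entering `p` continues along
the strand leaving `p'` (and symmetrically): `arcIn p ~ arcOut p'`; at the other chords the
reconnection reverses the orientation of one side: `arcIn p ~ arcIn p'` and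
`arcOut p ~ arcOut p'`. Loops (`a = b`, which arise when the two ends of a chord are
adjacent) are discarded, which does not affect connectivity. Viro (2004), §2, §5;
Khovanov (2000), §4.2. [cite: Viro2004] -/
def stateAdj (σ : G.State) (a b : G.Arc) : Prop :=
  a ≠ b ∧ ∃ p : Fin (2 * G.n),
    (G.isSeifert σ (G.chordOf p) = true ∧
      ((a = G.arcIn p ∧ b = G.arcOut (G.partner p)) ∨
        (b = G.arcIn p ∧ a = G.arcOut (G.partner p)))) ∨
    (G.isSeifert σ (G.chordOf p) = false ∧
      ((a = G.arcIn p ∧ b = G.arcIn (G.partner p)) ∨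
        (a = G.arcOut p ∧ b = G.arcOut (G.partner p))))

/-- The reconnection relation of a state is decidable (a finite disjunction of equalities in
`Fin`), so that state circles can be counted by `decide`. [folklore] -/
instance (σ : G.State) : DecidableRel (G.stateAdj σ) := fun a b ↦ by
  unfold stateAdj; infer_instance

/-- The **state graph** of the state `σ`: the simple graph on arcs generated
(`SimpleGraph.fromRel`: symmetrised, loops removed) by the reconnection relation `stateAdj σ`.
Its connected components are the circles of the complete resolution `σ`. Viro (2004), §2. [cite: Viro2004] -/
def stateGraph (σ : G.State) : SimpleGraph G.Arc :=
  SimpleGraph.fromRel (G.stateAdj σ)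

/-- Adjacency in the state graph is decidable. [folklore] -/
instance (σ : G.State) : DecidableRel (G.stateGraph σ).Adj := fun a b ↦ by
  unfold stateGraph; infer_instance

/-- The type of **state circles** of the state `σ`: the connected components of the resolved
1-manifold, i.e. of the state graph on arcs. It is a `Fintype`
(`Mathlib.Combinatorics.SimpleGraph.Connectivity.Finite`). Khovanov (2000), §4.2;
Bar-Natan (2002), §3.1; Viro (2004), §2. [cite: Khovanov2000] -/
abbrev StateCircle (σ : G.State) : Type := (G.stateGraph σ).ConnectedComponent

/-- Equality of state circles is decidable: `ConnectedComponent` is the quotient by the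
reachability setoid, and reachability in a finite graph with decidable adjacency is
decidable; core's `Quotient.decidableEq` is invoked by hand because `ConnectedComponent` is
defined as a `Quot`. [folklore] -/
instance (σ : G.State) : DecidableEq (G.StateCircle σ) :=
  @Quotient.decidableEq _ (G.stateGraph σ).reachableSetoid
    (fun a b ↦ inferInstanceAs (Decidable ((G.stateGraph σ).Reachable a b)))

/-- The **number of circles** of the complete resolution `σ`. Khovanov (2000), §4.2;
Bar-Natan (2002), §3.1 (the number `k` of cycles of a smoothing). [cite: Khovanov2000] -/
def circleCount (σ : G.State) : ℕ := Fintype.card (G.StateCircle σ)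

/-- The state circle containing the arc `a` in the state `σ`. [folklore] -/
def circleOf (σ : G.State) (a : G.Arc) : G.StateCircle σ :=
  (G.stateGraph σ).connectedComponentMk a

/-! ## Merge, split, or neither -/

/-- The edge `σ → σ[i ↦ 1]` of the cube of resolutions is a **merge** at chord `i`: `σ` takes
the `0`-smoothing at `i` and, *before* the flip, the two local strands at the site of chord
`i` — represented in every state by the arcs `arcIn (overPos i)` and `arcOut (overPos i)`,
which lie on different local strands for both types of smoothing — lie on different state
circles, so that the flip `0 → 1` at `i` merges these two circles into one.
For a Gauss diagram realised by a knot every edge is a merge or a split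
(`isMergeAt_or_isSplitAt_of_hasGaussDiagram`); for an abstract (possibly non-planar, i.e.
virtual) Gauss diagram a third case occurs: the two strands lie on the same circle before
*and* after the flip (a one-to-one, "single-cycle" bifurcation: surgery along an
orientation-reversing band), V. O. Manturov, *Khovanov homology for virtual knots with
arbitrary coefficients*, Izv. Math. 71 (2007), J. Knot Theory Ramifications 16 (2007);
Viro (2004), §5. Khovanov (2000), §4.2; Bar-Natan (2002), §3.1. [cite: Viro2004] -/
def IsMergeAt (σ : G.State) (i : Fin G.n) : Prop :=
  σ i = false ∧ G.circleOf σ (G.arcIn (G.overPos i)) ≠ G.circleOf σ (G.arcOut (G.overPos i))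

/-- The edge `σ → σ[i ↦ 1]` of the cube of resolutions is a **split** at chord `i`: `σ` takes
the `0`-smoothing at `i` and, *after* the flip (in the state `Function.update σ i true`), the
two local strands `arcIn (overPos i)`, `arcOut (overPos i)` lie on different state circles,
so that the flip `0 → 1` at `i` splits one circle into these two.
For virtual (non-realisable) Gauss diagrams an edge may be neither a merge nor a split
(one-to-one bifurcation; Manturov, Izv. Math. 71 (2007), J. Knot Theory Ramifications 16
(2007); Viro (2004), §5); for diagrams of knots see
`isMergeAt_or_isSplitAt_of_hasGaussDiagram`. Khovanov (2000), §4.2; Bar-Natan (2002),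
§3.1. [cite: Viro2004] -/
def IsSplitAt (σ : G.State) (i : Fin G.n) : Prop :=
  σ i = false ∧ G.circleOf (Function.update σ i true) (G.arcIn (G.overPos i)) ≠
    G.circleOf (Function.update σ i true) (G.arcOut (G.overPos i))

/-- Being a merge is decidable. [folklore] -/
instance (σ : G.State) (i : Fin G.n) : Decidable (G.IsMergeAt σ i) := by
  unfold IsMergeAt; infer_instance

/-- Being a split is decidable. [folklore] -/
instance (σ : G.State) (i : Fin G.n) : Decidable (G.IsSplitAt σ i) := by
  unfold IsSplitAt; infer_instance

variable {G} in
/-- A merge is not a split: flipping the smoothing at chord `i` replaces the two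
reconnections at `i` by the other pairing of the same four strand ends, so if the two local
strands lie on different circles before the flip they lie on one circle after it (surgery of
1-manifolds along a band joining two components yields one component). Viro (2004), §5;
Bar-Natan (2002), §3.1. [cite: Viro2004] -/
def IsMergeAt.not_isSplitAt : Prop :=
  ∀ {σ : G.State} {i : Fin G.n} (h : G.IsMergeAt σ i),
    ¬ G.IsSplitAt σ i

variable {G} in
/-- **Merge-or-split dichotomy for diagrams of knots.** If the Gauss diagram `G` is realised
by a knot (`Knot.HasGaussDiagram`, accepted `Literature.Prelude.FourManM.GaussDiagrams`), then at
every `0`-smoothed chord of every state the flip `0 → 1` is either a merge or a split: the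
state circles are disjoint embedded circles in the plane, and a planar saddle changes the
number of circles by exactly one (Jordan curve theorem; equivalently all bands of a planar
diagram are untwisted relative to the plane). This fails for virtual diagrams (Manturov
(2007); Viro (2004), §5). Khovanov (2000), §4.2; Bar-Natan (2002), §3.1. [cite: Viro2004] -/
def isMergeAt_or_isSplitAt_of_hasGaussDiagram : Prop :=
  ∀ {σ : G.State} {i : Fin G.n} (hG : ∃ K : Knot, K.HasGaussDiagram G) (hσ : σ i = false),
    G.IsMergeAt σ i ∨ G.IsSplitAt σ i

/-! ## Sanity data and checks of the sign rule -/

/-- The **kink** with sign `ε`: the one-chord Gauss diagram with over-passage at position `0`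
and under-passage at position `1`, i.e. the diagram of an unknot with one Reidemeister-I curl
of sign `ε`. It equals `GaussDiagram.empty.insertChord 0 0 ε` (the accepted `Ω1`
bookkeeping, `PolyakMove.omega1a`); an explicit literal is kept because it is what `decide`
evaluates fastest. Polyak (2010), Fig. 2; Bar-Natan (2002), §3.1. [cite: Polyak2010] -/
def kink (ε : ℤˣ) : GaussDiagram where
  n := 1
  overPos := fun _ ↦ 0
  underPos := fun _ ↦ 1
  sign := fun _ ↦ ε
  bijective := by decide

/-- The **right-handed trefoil** read from its standard three-crossing diagram: walking along
the knot from a base point one meets the crossings in the order `1 2 3 1 2 3`, alternately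
over and under, so chords `0, 1, 2` have over-passages at positions `0, 2, 4` and
under-passages at positions `3, 5, 1`; all three crossings are positive. Rolfsen (1976),
§3.A, knot `3₁`; Polyak (2010), §1; Bar-Natan (2002), §3.1 (the running example). [cite: Rolfsen1976] -/
def trefoilDiagram : GaussDiagram where
  n := 3
  overPos := ![0, 2, 4]
  underPos := ![3, 5, 1]
  sign := fun _ ↦ 1
  bijective := by decide

/-- The empty diagram (round unknot) has exactly one state circle in its unique state.
Bar-Natan (2002), §3.1 (the unknot). [cite: BarNatan2002] -/
theorem circleCount_empty : GaussDiagram.empty.circleCount Fin.elim0 = 1 := by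
  rw [circleCount, Fintype.card_eq_one_iff]
  refine ⟨GaussDiagram.empty.circleOf _ ⟨0, by simp [arcCount]⟩, fun c ↦ ?_⟩
  induction c using SimpleGraph.ConnectedComponent.ind with
  | h v => exact congrArg _ (Subsingleton.elim (α := Fin 1) _ _)

/-- The `0`-smoothing of the positive kink is Seifert's smoothing: two circles. (Guard on the
sign rule `isSeifert`.) Bar-Natan (2002), §3.1. [cite: BarNatan2002] -/
theorem circleCount_kink_false : (kink 1).circleCount (fun _ ↦ false) = 2 := by
  set_option maxRecDepth 4000 in decide

/-- The `1`-smoothing of the positive kink is the non-Seifert smoothing: one circle.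
Bar-Natan (2002), §3.1. [cite: BarNatan2002] -/
theorem circleCount_kink_true : (kink 1).circleCount (fun _ ↦ true) = 1 := by
  set_option maxRecDepth 4000 in decide

/-- The `0`-smoothing of the negative kink is the non-Seifert smoothing: one circle. (Guard on
the sign rule `isSeifert`.) Bar-Natan (2002), §3.1. [cite: BarNatan2002] -/
theorem circleCount_kink_neg_false : (kink (-1)).circleCount (fun _ ↦ false) = 1 := by
  set_option maxRecDepth 4000 in decide

/-- In the positive kink, the flip `0 → 1` at the unique chord is a merge (two circles become
one). Bar-Natan (2002), §3.1. [cite: BarNatan2002] -/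
theorem isMergeAt_kink : (kink 1).IsMergeAt (fun _ ↦ false) ⟨0, Nat.one_pos⟩ := by
  set_option maxRecDepth 4000 in decide

/-- In the positive kink, the flip `0 → 1` at the unique chord is not a split.
Bar-Natan (2002), §3.1. [cite: BarNatan2002] -/
theorem not_isSplitAt_kink : ¬ (kink 1).IsSplitAt (fun _ ↦ false) ⟨0, Nat.one_pos⟩ := by
  set_option maxRecDepth 4000 in decide

/-- The all-`0` resolution of the right-handed trefoil (all crossings positive, so this is
the oriented, Seifert resolution) has two circles (the two Seifert circles of the standard
diagram). Bar-Natan (2002), §3.1, Fig. 1. [cite: BarNatan2002] -/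
theorem circleCount_trefoil_false : trefoilDiagram.circleCount (fun _ ↦ false) = 2 := by
  set_option maxRecDepth 8000 in decide

/-- The all-`1` resolution of the right-handed trefoil has three circles. Bar-Natan (2002),
§3.1, Fig. 1. [cite: BarNatan2002] -/
theorem circleCount_trefoil_true : trefoilDiagram.circleCount (fun _ ↦ true) = 3 := by
  set_option maxRecDepth 8000 in decide

/-! ## Proof of `IsMergeAt.not_isSplitAt`: surgery along a band joining two circles

The proof is the combinatorial core of Viro's remark (Viro (2004), §5.2, p. 330): the resolved
1-manifolds of `σ` and of `σ[i ↦ 1]` differ by a single Morse modification of index `1` at the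
site of chord `i`, and a Morse modification joining two *distinct* circles produces one circle.
We argue on the `4n` *arc-ends* `(p, b) : Fin (2 * n) × Bool` (`b = false`: the end of
`arcIn p` at the marked point `p`; `b = true`: the end of `arcOut p` at `p`), with the two
fixed-point-free involutions `endFlip` (the other end of the same arc) and `endGlue σ` (the end
glued to it by the smoothings of `σ`). A set of arcs closed under the gluings at the chords
`≠ i` meets an *even* number of the four ends at chord `i` (parity count), which forces the
two local strands to be joined after the flip if they were separated before it. -/

section NotSplit

/-- The arc carrying an arc-end: `(p, false) ↦ arcIn p`, `(p, true) ↦ arcOut p`. [folklore] -/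
def endArc : Fin (2 * G.n) × Bool → G.Arc
  | (p, false) => G.arcIn p
  | (p, true) => G.arcOut p

/-- Cyclic successor of a marked point (`p + 1 (mod 2n)`). [folklore] -/
def succPt (p : Fin (2 * G.n)) : Fin (2 * G.n) :=
  ⟨(p.val + 1) % (2 * G.n), Nat.mod_lt _ (by have := p.isLt; omega)⟩

/-- Cyclic predecessor of a marked point (`p - 1 (mod 2n)`). [folklore] -/
def predPt (p : Fin (2 * G.n)) : Fin (2 * G.n) :=
  ⟨(p.val + 2 * G.n - 1) % (2 * G.n), Nat.mod_lt _ (by have := p.isLt; omega)⟩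

/-- `((p + 1) mod m) - 1 ≡ p (mod m)` for `p < m` (cyclic predecessor of the cyclic successor).
[folklore] -/
private theorem mod_succ_pred {m p : ℕ} (hp : p < m) : ((p + 1) % m + m - 1) % m = p := by
  rcases Nat.lt_or_ge (p + 1) m with h | h
  · rw [Nat.mod_eq_of_lt h, show p + 1 + m - 1 = p + m by omega, Nat.add_mod_right,
      Nat.mod_eq_of_lt hp]
  · rw [show p + 1 = m by omega, Nat.mod_self, show 0 + m - 1 = p by omega, Nat.mod_eq_of_lt hp]

/-- `((p - 1) mod m) + 1 ≡ p (mod m)` for `p < m` (cyclic successor of the cyclic predecessor).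
[folklore] -/
private theorem mod_pred_succ {m p : ℕ} (hp : p < m) : ((p + m - 1) % m + 1) % m = p := by
  rcases Nat.eq_zero_or_pos p with rfl | h
  · rw [show 0 + m - 1 = m - 1 by omega, Nat.mod_eq_of_lt (show m - 1 < m by omega),
      show m - 1 + 1 = m by omega, Nat.mod_self]
  · rw [show p + m - 1 = (p - 1) + m by omega, Nat.add_mod_right,
      Nat.mod_eq_of_lt (show p - 1 < m by omega), show p - 1 + 1 = p by omega, Nat.mod_eq_of_lt hp]

/-- `predPt ∘ succPt = id`. [folklore] -/
@[simp]
theorem predPt_succPt (p : Fin (2 * G.n)) : G.predPt (G.succPt p) = p :=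
  Fin.ext (mod_succ_pred p.isLt)

/-- `succPt ∘ predPt = id`. [folklore] -/
@[simp]
theorem succPt_predPt (p : Fin (2 * G.n)) : G.succPt (G.predPt p) = p :=
  Fin.ext (mod_pred_succ p.isLt)

/-- The arc entering `p + 1` is the arc leaving `p`. [folklore] -/
@[simp]
theorem arcIn_succPt (p : Fin (2 * G.n)) : G.arcIn (G.succPt p) = G.arcOut p :=
  Fin.ext (mod_succ_pred p.isLt)

/-- The arc leaving `p - 1` is the arc entering `p`. [folklore] -/
@[simp]
theorem arcOut_predPt (p : Fin (2 * G.n)) : G.arcOut (G.predPt p) = G.arcIn p := rfl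

/-- The **other end of the same arc**: the end of `arcIn p` at `p` is matched with the end of the
same arc `arcOut (p - 1)` at `p - 1`, and symmetrically. [folklore] -/
def endFlip : Fin (2 * G.n) × Bool → Fin (2 * G.n) × Bool
  | (p, false) => (G.predPt p, true)
  | (p, true) => (G.succPt p, false)

/-- `endFlip` is an involution. [folklore] -/
@[simp]
theorem endFlip_endFlip (e : Fin (2 * G.n) × Bool) : G.endFlip (G.endFlip e) = e := by
  obtain ⟨p, _ | _⟩ := e <;> simp [endFlip]

/-- `endFlip` has no fixed point. [folklore] -/
theorem endFlip_ne (e : Fin (2 * G.n) × Bool) : G.endFlip e ≠ e := by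
  obtain ⟨p, _ | _⟩ := e <;> simp [endFlip]

/-- The two ends matched by `endFlip` lie on the same arc. [folklore] -/
@[simp]
theorem endArc_endFlip (e : Fin (2 * G.n) × Bool) : G.endArc (G.endFlip e) = G.endArc e := by
  obtain ⟨p, _ | _⟩ := e <;> simp [endFlip, endArc]

/-- The **gluing** of arc-ends in the state `σ`: the end `(p, b)` is glued to the end at the
partner point `partner p`, of the opposite kind (`in ↔ out`) at a Seifert chord and of the same
kind at a non-Seifert chord (cf. `stateAdj`). Viro (2004), §2, §5. [cite: Viro2004] -/
def endGlue (σ : G.State) : Fin (2 * G.n) × Bool → Fin (2 * G.n) × Bool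
  | (p, b) => (G.partner p, if G.isSeifert σ (G.chordOf p) then !b else b)

/-- A marked point is never its own partner. [folklore] -/
theorem partner_ne (p : Fin (2 * G.n)) : G.partner p ≠ p := by
  obtain ⟨i, rfl | rfl⟩ := G.exists_chord p
  · simpa using (G.overPos_ne_underPos i i).symm
  · simpa using G.overPos_ne_underPos i i

/-- `endGlue σ` is an involution. [folklore] -/
@[simp]
theorem endGlue_endGlue (σ : G.State) (e : Fin (2 * G.n) × Bool) :
    G.endGlue σ (G.endGlue σ e) = e := by
  obtain ⟨p, b⟩ := e
  cases hs : G.isSeifert σ (G.chordOf p) <;> cases b <;> simp [endGlue, hs]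

/-- `endGlue σ` has no fixed point. [folklore] -/
theorem endGlue_ne (σ : G.State) (e : Fin (2 * G.n) × Bool) : G.endGlue σ e ≠ e := by
  obtain ⟨p, b⟩ := e
  simp only [endGlue, ne_eq, Prod.mk.injEq, not_and]
  exact fun h ↦ absurd h (G.partner_ne p)

/-- Glued ends lie on the same state circle: their arcs are equal or adjacent in the state
graph. [folklore] -/
theorem reachable_endArc_endGlue (σ : G.State) (e : Fin (2 * G.n) × Bool) :
    (G.stateGraph σ).Reachable (G.endArc e) (G.endArc (G.endGlue σ e)) := by
  by_cases heq : G.endArc e = G.endArc (G.endGlue σ e)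
  · rw [← heq]
  refine SimpleGraph.Adj.reachable ?_
  rw [stateGraph, SimpleGraph.fromRel_adj]
  refine ⟨heq, Or.inl ⟨heq, ?_⟩⟩
  obtain ⟨p, b⟩ := e
  cases hs : G.isSeifert σ (G.chordOf p) <;> cases b
  · exact ⟨p, Or.inr ⟨hs, Or.inl ⟨rfl, by simp [endArc, endGlue, hs]⟩⟩⟩
  · exact ⟨p, Or.inr ⟨hs, Or.inr ⟨rfl, by simp [endArc, endGlue, hs]⟩⟩⟩
  · exact ⟨p, Or.inl ⟨hs, Or.inl ⟨rfl, by simp [endArc, endGlue, hs]⟩⟩⟩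
  · refine ⟨G.partner p, Or.inl ⟨by simpa using hs, Or.inr ⟨?_, ?_⟩⟩⟩ <;>
      simp [endArc, endGlue, hs]

/-- The chord through a point other than the two ends of chord `i` is not `i`. [folklore] -/
theorem chordOf_ne {p : Fin (2 * G.n)} {i : Fin G.n} (ho : p ≠ G.overPos i)
    (hu : p ≠ G.underPos i) : G.chordOf p ≠ i := by
  rintro rfl
  rcases G.chordOf_spec p with h | h
  · exact ho h.symm
  · exact hu h.symm

/-- The Seifert rule at a chord `j ≠ i` does not see a change of smoothing at `i`. [folklore] -/
theorem isSeifert_update_of_ne (σ : G.State) {i j : Fin G.n} (b : Bool) (h : j ≠ i) :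
    G.isSeifert (Function.update σ i b) j = G.isSeifert σ j := by
  simp [isSeifert, Function.update_of_ne h]

/-- The gluing of an end away from chord `i` does not see a change of smoothing at `i`.
[folklore] -/
theorem endGlue_update_of_ne (σ : G.State) {i : Fin G.n} (b : Bool) {e : Fin (2 * G.n) × Bool}
    (ho : e.1 ≠ G.overPos i) (hu : e.1 ≠ G.underPos i) :
    G.endGlue (Function.update σ i b) e = G.endGlue σ e := by
  obtain ⟨p, c⟩ := e
  simp only [endGlue, G.isSeifert_update_of_ne σ b (G.chordOf_ne ho hu)]

/-- A finite set carrying a fixed-point-free involution has even cardinality. [folklore] -/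
theorem even_card_of_involutive {α : Type*} (s : Finset α) (g : α → α)
    (h_mem : ∀ a ∈ s, g a ∈ s) (h_inv : ∀ a ∈ s, g (g a) = a)
    (h_ne : ∀ a ∈ s, g a ≠ a) :
    Even s.card := by
  have h := Finset.sum_involution (s := s) (f := fun _ ↦ (1 : ZMod 2)) (fun a _ ↦ g a)
    (fun a _ ↦ by decide) (fun a ha _ ↦ h_ne a ha) (fun a ha ↦ h_mem a ha)
    (fun a ha ↦ h_inv a ha)
  rw [Finset.sum_const, nsmul_eq_mul, mul_one] at h
  exact ZMod.natCast_eq_zero_iff_even.mp h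

/-- **Parity count.** Let `K` be a set of arcs closed under the gluings of the state `σ` at all
chords other than `i`. Then `K` carries an even number of the four arc-ends at chord `i`
(every arc has two ends, and the ends away from chord `i` that lie on `K` are matched in pairs
by the gluing). [folklore] -/
theorem even_card_ends_at (σ : G.State) (i : Fin G.n) (K : Set G.Arc) [DecidablePred (· ∈ K)]
    (hK : ∀ e : Fin (2 * G.n) × Bool, e.1 ≠ G.overPos i → e.1 ≠ G.underPos i →
      G.endArc e ∈ K → G.endArc (G.endGlue σ e) ∈ K) :
    Even (Finset.univ.filter fun e : Fin (2 * G.n) × Bool ↦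
      G.endArc e ∈ K ∧ (e.1 = G.overPos i ∨ e.1 = G.underPos i)).card := by
  classical
  set T : Finset (Fin (2 * G.n) × Bool) := Finset.univ.filter fun e ↦ G.endArc e ∈ K with hT
  set S : Finset (Fin (2 * G.n) × Bool) :=
    Finset.univ.filter fun e ↦ e.1 = G.overPos i ∨ e.1 = G.underPos i with hS
  have hTS : (Finset.univ.filter fun e : Fin (2 * G.n) × Bool ↦
      G.endArc e ∈ K ∧ (e.1 = G.overPos i ∨ e.1 = G.underPos i)) = T ∩ S := by
    ext e; simp [hT, hS]
  rw [hTS]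
  -- every arc has two ends: `T` is `endFlip`-invariant
  have h₁ : Even T.card := by
    refine even_card_of_involutive T G.endFlip (fun e he ↦ ?_) (fun e _ ↦ G.endFlip_endFlip e)
      (fun e _ ↦ G.endFlip_ne e)
    simpa [hT] using he
  -- the ends of `T` away from chord `i` are matched by the gluing
  have h₂ : Even (T \ S).card := by
    refine even_card_of_involutive (T \ S) (G.endGlue σ) (fun e he ↦ ?_)
      (fun e _ ↦ G.endGlue_endGlue σ e) (fun e _ ↦ G.endGlue_ne σ e)
    simp only [Finset.mem_sdiff, hT, hS, Finset.mem_filter, Finset.mem_univ, true_and,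
      not_or] at he ⊢
    obtain ⟨heK, ho, hu⟩ := he
    refine ⟨hK e ho hu heK, ?_, ?_⟩
    · -- partner of a point ≠ overPos i, underPos i is ≠ overPos i
      intro h
      apply hu
      have := congrArg G.partner h
      obtain ⟨p, b⟩ := e
      simpa [endGlue] using this
    · intro h
      apply ho
      have := congrArg G.partner h
      obtain ⟨p, b⟩ := e
      simpa [endGlue] using this
  have h₃ := Finset.card_sdiff_add_card_inter T S
  rw [← h₃] at h₁
  exact (Nat.even_add.mp h₁).mp h₂

variable {G} in
/-- **A merge is not a split** (`IsMergeAt.not_isSplitAt` holds): if the two local strands at a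
`0`-smoothed chord `i` lie on different state circles, then after the flip `0 → 1` at `i` they
lie on the same state circle. This is the planarity-free half of Viro's remark that incident
states differ by a single Morse modification of index `1`, which either joins two circles or
splits one (Viro (2004), §5.2, p. 330; Bar-Natan (2002), §3.1): surgery of a closed
1-manifold along a band joining two distinct components yields one component, for abstract
(possibly virtual) Gauss diagrams as well. Proof: parity count of the ends at chord `i` lying
on the set of arcs reachable from `arcIn (overPos i)` both before and after the flip
(`even_card_ends_at`). [cite: Viro2004, §5.2] -/
theorem IsMergeAt.not_isSplitAt_holds : IsMergeAt.not_isSplitAt (G := G) := by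
  intro σ i hM hS
  classical
  set σ' : G.State := Function.update σ i true with hσ'
  set o := G.overPos i with ho
  set u := G.underPos i with hu
  obtain ⟨hσi, hM⟩ := hM
  obtain ⟨-, hS⟩ := hS
  rw [circleOf, circleOf, Ne, SimpleGraph.ConnectedComponent.eq] at hM hS
  -- the arcs reachable from `A = arcIn o` both before and after the flip
  set K : Set G.Arc := {a | (G.stateGraph σ).Reachable (G.arcIn o) a ∧
    (G.stateGraph σ').Reachable (G.arcIn o) a} with hK
  have hKcl : ∀ e : Fin (2 * G.n) × Bool, e.1 ≠ o → e.1 ≠ u →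
      G.endArc e ∈ K → G.endArc (G.endGlue σ e) ∈ K := by
    intro e h1 h2 ⟨hr, hr'⟩
    refine ⟨hr.trans (G.reachable_endArc_endGlue σ e), hr'.trans ?_⟩
    rw [← G.endGlue_update_of_ne σ true h1 h2]
    exact G.reachable_endArc_endGlue σ' e
  have hev := G.even_card_ends_at σ i K hKcl
  -- the end `(o, in)` of `A` lies on `K`; hence so does another end at chord `i`
  have hA : G.endArc (o, false) ∈ K :=
    ⟨SimpleGraph.Reachable.refl _, SimpleGraph.Reachable.refl _⟩
  have key : G.endArc (o, true) ∈ K ∨ ∃ b, G.endArc (u, b) ∈ K := by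
    by_contra hcon
    push Not at hcon
    obtain ⟨hB, hC⟩ := hcon
    have : (Finset.univ.filter fun e : Fin (2 * G.n) × Bool ↦
        G.endArc e ∈ K ∧ (e.1 = G.overPos i ∨ e.1 = G.underPos i)) = {(o, false)} := by
      ext ⟨p, b⟩
      simp only [Finset.mem_filter, Finset.mem_univ, true_and, Finset.mem_singleton,
        Prod.mk.injEq]
      constructor
      · rintro ⟨hk, rfl | rfl⟩
        · cases b
          · exact ⟨rfl, rfl⟩
          · exact absurd hk hB
        · exact absurd hk (hC b)
      · rintro ⟨rfl, rfl⟩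
        exact ⟨hA, Or.inl rfl⟩
    rw [this, Finset.card_singleton] at hev
    exact Nat.not_even_one hev
  rcases key with hB | ⟨b, hb⟩
  · -- `B = arcOut o` reachable from `A` before the flip: not a merge
    exact hM hB.1
  · -- an end at `u` lies on `K`; it is glued to `(o, out)` either before or after the flip
    have hglue : G.endGlue σ (u, b) = (o, true) ∨ G.endGlue σ' (u, b) = (o, true) := by
      have h1 : G.chordOf u = i := G.chordOf_underPos i
      have h2 : G.partner u = o := G.partner_underPos i
      simp only [endGlue, h1, h2, isSeifert, hσ', Function.update_self, hσi, Prod.mk.injEq,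
        true_and]
      cases b <;> cases (G.sign i == 1) <;> simp
    rcases hglue with h | h
    · have := G.reachable_endArc_endGlue σ (u, b)
      rw [h] at this
      exact hM (hb.1.trans this)
    · have := G.reachable_endArc_endGlue σ' (u, b)
      rw [h] at this
      exact hS (hb.2.trans this)

end NotSplit

end GaussDiagram

end Literature.Topology.FourManifolds
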